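import Summits.QuantumFields.BalabanUV.Beta.RootedMixedTableLaw
import Summits.QuantumFields.BalabanUV.Beta.WardSiteToBlock

/-!
# `BalabanUV.Beta.RowD1MixedDischarged` — binder row D1 in bond currency with the MIXED REFLECTION BOND LAW DISCHARGED («RX-M4»;
# β sub-cell, D1 formalisation swarm, leaf-05 gen 8)

HONEST FRAMING (cell charter, verbatim): «discharging BetaPertH makes Balaban's UV stability UNCONDITIONAL — a real
constructive-QFT result; it is NOT the continuum limit and NOT the Clay problem.»
HONEST DEPENDENCY: continuum YM on T⁴ ⇐ BetaPertH ∧ nine spine estimates (0/9 proved); BetaPertH ⇐ (D1) ∧ (D4) ∧ CAP+tail;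
G-an2-4 gates asym, D1 and NE2/3/4.
DERIVED cell leaf ([folklore] wiring, no estimate).  an3-g33's AN3-33M4 `RootedMixedTableLaw.bondLaw (hLc : Odd Lc)` (tree) PROVES the first of the
four bond-level identities of RX `RowD1FromBondLaws` — the mixed reflection bond law `hMb` — UNCONDITIONALLY at odd `Lc`; this file re-issues RX ∕ WX5
with that hypothesis (and the bookkeeping binder `γ`∕`hγ`, instantiated at its displayed value) REMOVED.  What is left, BY NAME and VERBATIM from RX ∕ WX5:
the symmetrised BORDER reflection bond law `hBb` (BX2's `hB`; an3's 33K target), the border Ward identity `hWb` (WX4, at lockB `cB = −Lc¹²∕4`) or its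
site form `hSB` (W2-B), the mixed Ward identity `hWM` (K-W1 (WM-bond), at the Λ-lock `cΛ = 2∕Lc⁴`) or its site form `hSM` (W2-M), and the route
binders `D1Tel` ∕ `D1Rep`.  ALL of these remain HYPOTHESES; no statement of Bałaban's papers, no `[cite:]`, no definition, no `Prop` fact; 0∕4 binders
(hW, hR, D1Tel, D1Rep) discharged — hR for the literal of record now rests on ONE displayed identity (`hBb`).  NOT D1, NOT BetaPertH, NOT continuum, NOT Clay.

* §1 **`axisReflectionCovariant_flipK_TbalOf_JsRowD1_of_borderBondLaw`** (Λ-lock `cΛ·Lc⁴ = 2`, `cB = −Lc¹²∕4`) and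
  **`axisReflectionCovariant_flipK_TbalOf_JsRowD1Pin_of_borderBondLaw`**: hR ⟸ `hBb` ALONE (+ `Odd Lc`, `2 ≤ N`).
* §2 **`symmetries_JsRowD1Pin_of_borderBondLaw_bondWard`** (hW ∧ hR ⟸ `hBb` ∧ `hWb` ∧ `hWM`) and **`symmetries_JsRowD1Pin_of_borderBondLaw_siteLaws`**
  (hW ∧ hR ⟸ `hBb` ∧ (W2-B) ∧ (W2-M)).
* §3 **`d1Drift_JsRowD1Pin_of_borderLaws_D1Tel_D1Rep`** (`D1Drift Lc (JsRowD1Pin hLc N) Nc μ ν` ⟸ `hBb` ∧ `hWb` ∧ `hWM` ∧ D1Tel ∧ D1Rep + the route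
  theorem's own binders, verbatim from RX) and **`d1Drift_JsRowD1Pin_of_borderBondLaw_siteLaws_D1Tel_D1Rep`** (the same with the two SITE Ward laws).
Provenance: β sub-cell, D1 formalisation swarm, unit b2b-balaban-beta-d1-formalise-leaf-05 gen 8, 2026-08-20 (v1); no existing file touched.
-/

open Finset
open scoped BigOperators
open Literature.MathematicalPhysics.QuantumFieldTheory
open Literature.MathematicalPhysics.QuantumFieldTheory.Balaban1983to89
open Literature.MathematicalPhysics.QuantumFieldTheory.Balaban1983to89.Beta
open ExpKernelCalculus (MKer)
open AffineAveraging (box toSite)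
open AveragingContours (blk off)
open AveragingContoursRooted (ctrOff)
open AveragingHessianKernelsRooted (vhKerAt linKerAt hessKerAt)
open AveragingMixedJetTables (vh2KerAt mixKerAt)
open PolarizationSign (reflSign WardTransversal AxisReflectionCovariant)
open ResolventReflection (bref)
open OneStepResolventKernel (Fib JetData)
open OneStepKernelFamily (TbalOf flipK D1Tel D1Rep D1Drift d1Drift_of_D1Tel_D1Rep)
open Literature.MathematicalPhysics.QuantumFieldTheory.Balaban1983to89.Beta.VectorTailsLoc (fam kfam)
open Literature.MathematicalPhysics.QuantumFieldTheory.Balaban1983to89.Beta.VectorLegVolumeAdapter (MvE)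
open B6BondElimination (unitVec)
open BalabanStepJetsSucc (wVH)
open Summit.QuantumFields.BalabanUV.Beta.BorderedHessian (stepScale)
open Summit.QuantumFields.BalabanUV.Beta.RowD1JointEnd (JsRowD1 JsRowD1Pin lockΛ_pin)
open Summit.QuantumFields.BalabanUV.Beta.RowD1FromBondLaws (axisReflectionCovariant_flipK_TbalOf_JsRowD1_of_bondLaws
  symmetries_JsRowD1Pin_of_bondLaws)
open Summit.QuantumFields.BalabanUV.Beta.WardSiteToBlock (symmetries_JsRowD1Pin_of_siteLaws)
open Summit.QuantumFields.BalabanUV.Beta.RootedMixedTableLaw (bondLaw)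

namespace Summit.QuantumFields.BalabanUV.Beta.RowD1MixedDischarged

noncomputable section

variable {Lc : ℕ} [NeZero Lc]

/-! ## §1 hR for the row literal from the BORDER reflection bond law alone -/

open Classical in
/-- [folklore] **hR FOR `JsRowD1 hLc N cΛ (−Lc¹²∕4)` FROM THE SYMMETRISED BORDER REFLECTION BOND LAW `hBb` ALONE** (Λ-lock `cΛ·Lc⁴ = 2`):
RX `axisReflectionCovariant_flipK_TbalOf_JsRowD1_of_bondLaws` with `hMb := RootedMixedTableLaw.bondLaw hLc` (an3's 33M4, a theorem of the tree) and
the bookkeeping weight `γ j := −(Lc⁸∕2)·wVH 3 Lc j ∕ (stepScale 3 Lc j·Lc⁴)` instantiated at its displayed value.  `hBb` is a HYPOTHESIS. -/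
theorem axisReflectionCovariant_flipK_TbalOf_JsRowD1_of_borderBondLaw (hLc : Odd Lc) {N : ℕ} (hN : 2 ≤ N) {cΛ : ℝ}
    (hΛ : cΛ * (Lc : ℝ) ^ 4 = 2)
    (hBb : ∀ (α m : Fin 4) (y : Fin 4 → ℤ) (β : Fin 4) (x : Fin 4 → ℤ) (κ : Fin 4) (u : Fin 4 → ℤ) (κ' : Fin 4) (u' : Fin 4 → ℤ),
      reflSign α β * reflSign α κ * reflSign α κ' * reflSign α m *
          (vh2KerAt (toSite (ctrOff 4 Lc)) Lc m (bref α m y) (β, bref α β x) (κ, bref α κ u) (κ', bref α κ' u')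
            + vh2KerAt (toSite (ctrOff 4 Lc)) Lc m (bref α m y) (β, bref α β x) (κ', bref α κ' u') (κ, bref α κ u))
        = (vh2KerAt (toSite (ctrOff 4 Lc)) Lc m y (β, x) (κ, u) (κ', u') + vh2KerAt (toSite (ctrOff 4 Lc)) Lc m y (β, x) (κ', u') (κ, u))
          + 2 * (vhKerAt (toSite (ctrOff 4 Lc)) Lc m y (β, x) (κ', u')
                  * ((if m = α then linKerAt (toSite (ctrOff 4 Lc)) Lc m y (κ, u) else 0) - (if x = u ∧ β = κ ∧ κ = α then 1 else 0))
                + vhKerAt (toSite (ctrOff 4 Lc)) Lc m y (β, x) (κ, u)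
                  * ((if m = α then linKerAt (toSite (ctrOff 4 Lc)) Lc m y (κ', u') else 0) - (if x = u' ∧ β = κ' ∧ κ' = α then 1 else 0))
                + linKerAt (toSite (ctrOff 4 Lc)) Lc m y (β, x)
                  * ((if m = α then linKerAt (toSite (ctrOff 4 Lc)) Lc m y (κ, u) else 0) - (if x = u ∧ β = κ ∧ κ = α then 1 else 0))
                  * ((if m = α then linKerAt (toSite (ctrOff 4 Lc)) Lc m y (κ', u') else 0) - (if x = u' ∧ β = κ' ∧ κ' = α then 1 else 0)))) :
    ∀ j : ℕ, AxisReflectionCovariant (flipK (TbalOf Lc (JsRowD1 hLc N cΛ (-((Lc : ℝ) ^ 12 / 4))) j)) :=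
  axisReflectionCovariant_flipK_TbalOf_JsRowD1_of_bondLaws hLc hN hΛ
    (fun j => -((Lc : ℝ) ^ 8 / 2) * wVH 3 Lc j / (stepScale 3 Lc j * (Lc : ℝ) ^ 4)) (fun _ => rfl) (bondLaw hLc) hBb

open Classical in
/-- [folklore] **hR FOR THE PINNED LITERAL OF RECORD `JsRowD1Pin hLc N` FROM `hBb` ALONE** (`Odd Lc`, `2 ≤ N`; the Λ-lock is `lockΛ_pin`).  On the landing
of an3's border table law (33K: `hBb` as a theorem) this closes the hR binder of `OneStepKernelFamily.d1Drift_of_D1Tel_D1Rep` for the literal of record in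
one application.  `hBb` is a HYPOTHESIS here. -/
theorem axisReflectionCovariant_flipK_TbalOf_JsRowD1Pin_of_borderBondLaw (hLc : Odd Lc) {N : ℕ} (hN : 2 ≤ N)
    (hBb : ∀ (α m : Fin 4) (y : Fin 4 → ℤ) (β : Fin 4) (x : Fin 4 → ℤ) (κ : Fin 4) (u : Fin 4 → ℤ) (κ' : Fin 4) (u' : Fin 4 → ℤ),
      reflSign α β * reflSign α κ * reflSign α κ' * reflSign α m *
          (vh2KerAt (toSite (ctrOff 4 Lc)) Lc m (bref α m y) (β, bref α β x) (κ, bref α κ u) (κ', bref α κ' u')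
            + vh2KerAt (toSite (ctrOff 4 Lc)) Lc m (bref α m y) (β, bref α β x) (κ', bref α κ' u') (κ, bref α κ u))
        = (vh2KerAt (toSite (ctrOff 4 Lc)) Lc m y (β, x) (κ, u) (κ', u') + vh2KerAt (toSite (ctrOff 4 Lc)) Lc m y (β, x) (κ', u') (κ, u))
          + 2 * (vhKerAt (toSite (ctrOff 4 Lc)) Lc m y (β, x) (κ', u')
                  * ((if m = α then linKerAt (toSite (ctrOff 4 Lc)) Lc m y (κ, u) else 0) - (if x = u ∧ β = κ ∧ κ = α then 1 else 0))
                + vhKerAt (toSite (ctrOff 4 Lc)) Lc m y (β, x) (κ, u)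
                  * ((if m = α then linKerAt (toSite (ctrOff 4 Lc)) Lc m y (κ', u') else 0) - (if x = u' ∧ β = κ' ∧ κ' = α then 1 else 0))
                + linKerAt (toSite (ctrOff 4 Lc)) Lc m y (β, x)
                  * ((if m = α then linKerAt (toSite (ctrOff 4 Lc)) Lc m y (κ, u) else 0) - (if x = u ∧ β = κ ∧ κ = α then 1 else 0))
                  * ((if m = α then linKerAt (toSite (ctrOff 4 Lc)) Lc m y (κ', u') else 0) - (if x = u' ∧ β = κ' ∧ κ' = α then 1 else 0)))) :
    ∀ j : ℕ, AxisReflectionCovariant (flipK (TbalOf Lc (JsRowD1Pin hLc N) j)) :=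
  axisReflectionCovariant_flipK_TbalOf_JsRowD1_of_borderBondLaw hLc hN (lockΛ_pin hLc) hBb

/-! ## §2 hW ∧ hR for the pinned literal: three identities left -/

open Classical in
/-- [folklore] **hW ∧ hR FOR `JsRowD1Pin hLc N` FROM `hBb` ∧ `hWb` ∧ `hWM`** (border reflection bond law, border Ward bond identity at
`cB = −Lc¹²∕4`, mixed Ward bond identity at `cΛ = 2∕Lc⁴` — all three HYPOTHESES, verbatim from RX): RX `symmetries_JsRowD1Pin_of_bondLaws` with
`hMb := RootedMixedTableLaw.bondLaw hLc` and `γ` instantiated. -/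
theorem symmetries_JsRowD1Pin_of_borderBondLaw_bondWard (hLc : Odd Lc) {N : ℕ} (hN : 2 ≤ N)
    (hBb : ∀ (α m : Fin 4) (y : Fin 4 → ℤ) (β : Fin 4) (x : Fin 4 → ℤ) (κ : Fin 4) (u : Fin 4 → ℤ) (κ' : Fin 4) (u' : Fin 4 → ℤ),
      reflSign α β * reflSign α κ * reflSign α κ' * reflSign α m *
          (vh2KerAt (toSite (ctrOff 4 Lc)) Lc m (bref α m y) (β, bref α β x) (κ, bref α κ u) (κ', bref α κ' u')
            + vh2KerAt (toSite (ctrOff 4 Lc)) Lc m (bref α m y) (β, bref α β x) (κ', bref α κ' u') (κ, bref α κ u))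
        = (vh2KerAt (toSite (ctrOff 4 Lc)) Lc m y (β, x) (κ, u) (κ', u') + vh2KerAt (toSite (ctrOff 4 Lc)) Lc m y (β, x) (κ', u') (κ, u))
          + 2 * (vhKerAt (toSite (ctrOff 4 Lc)) Lc m y (β, x) (κ', u')
                  * ((if m = α then linKerAt (toSite (ctrOff 4 Lc)) Lc m y (κ, u) else 0) - (if x = u ∧ β = κ ∧ κ = α then 1 else 0))
                + vhKerAt (toSite (ctrOff 4 Lc)) Lc m y (β, x) (κ, u)
                  * ((if m = α then linKerAt (toSite (ctrOff 4 Lc)) Lc m y (κ', u') else 0) - (if x = u' ∧ β = κ' ∧ κ' = α then 1 else 0))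
                + linKerAt (toSite (ctrOff 4 Lc)) Lc m y (β, x)
                  * ((if m = α then linKerAt (toSite (ctrOff 4 Lc)) Lc m y (κ, u) else 0) - (if x = u ∧ β = κ ∧ κ = α then 1 else 0))
                  * ((if m = α then linKerAt (toSite (ctrOff 4 Lc)) Lc m y (κ', u') else 0) - (if x = u' ∧ β = κ' ∧ κ' = α then 1 else 0))))
    (hWb : ∀ (Y : Fin 4 → ℤ) (κ' : Fin 4) (u' x z : Fin 4 → ℤ) (β m : Fin 4), off Lc z = 0 →
      (stepScale 3 Lc 0 * (Lc : ℝ) ^ (3 + 1))⁻¹ *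
          ∑ v ∈ box (3 + 1) Lc, ∑ κ : Fin (3 + 1),
            ((-((Lc : ℝ) ^ 12 / 4)) * ((1 / 2 : ℝ) * (vh2KerAt (toSite (ctrOff 4 Lc)) Lc m (blk Lc z) (β, x) (κ, (Lc : ℤ) • Y + toSite v - unitVec κ) (κ', u')
                + vh2KerAt (toSite (ctrOff 4 Lc)) Lc m (blk Lc z) (β, x) (κ', u') (κ, (Lc : ℤ) • Y + toSite v - unitVec κ)))
              - (-((Lc : ℝ) ^ 12 / 4)) * ((1 / 2 : ℝ) * (vh2KerAt (toSite (ctrOff 4 Lc)) Lc m (blk Lc z) (β, x) (κ, (Lc : ℤ) • Y + toSite v) (κ', u')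
                + vh2KerAt (toSite (ctrOff 4 Lc)) Lc m (blk Lc z) (β, x) (κ', u') (κ, (Lc : ℤ) • Y + toSite v)))) =
        (-((Lc : ℝ) ^ (3 + 1) * (1 / 2) * (Lc : ℝ) ^ (3 + 1))) * vhKerAt (toSite (ctrOff 4 Lc)) Lc m (blk Lc z) (β, x) (κ', u')
            * ((1 / 2 : ℝ) * ∑ v ∈ box (3 + 1) Lc, (if z + toSite (ctrOff 4 Lc) = (Lc : ℤ) • Y + toSite v then (1 : ℝ) else 0))
          - ((1 / 2 : ℝ) * ∑ v ∈ box (3 + 1) Lc, (if x = (Lc : ℤ) • Y + toSite v then (1 : ℝ) else 0))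
            * ((-((Lc : ℝ) ^ (3 + 1) * (1 / 2) * (Lc : ℝ) ^ (3 + 1))) * vhKerAt (toSite (ctrOff 4 Lc)) Lc m (blk Lc z) (β, x) (κ', u')))
    (hWM : ∀ (y : Fin (3 + 1) → ℤ) (ρ' : Fin (3 + 1)) (w : Fin (3 + 1) → ℤ) (β : Fin (3 + 1)) (x : Fin (3 + 1) → ℤ) (β' : Fin (3 + 1))
      (x' : Fin (3 + 1) → ℤ),
      ((Lc : ℝ) ^ (3 + 1))⁻¹ * (∑ v ∈ box (3 + 1) Lc, ∑ κ : Fin (3 + 1),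
          ((mixKerAt (toSite (ctrOff 4 Lc)) Lc ρ' w (κ, (Lc : ℤ) • y + toSite v - unitVec κ) (β, x) (β', x')
              - mixKerAt (toSite (ctrOff 4 Lc)) Lc ρ' w (κ, (Lc : ℤ) • y + toSite v) (β, x) (β', x'))
            + (mixKerAt (toSite (ctrOff 4 Lc)) Lc ρ' w (κ, (Lc : ℤ) • y + toSite v - unitVec κ) (β', x') (β, x)
              - mixKerAt (toSite (ctrOff 4 Lc)) Lc ρ' w (κ, (Lc : ℤ) • y + toSite v) (β', x') (β, x)))) =
        2 * ((2 / (Lc : ℝ) ^ 4) * hessKerAt (toSite (ctrOff 4 Lc)) Lc ρ' w (β, x) (β', x') *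
          ((1 / 2 : ℝ) * (∑ v ∈ box (3 + 1) Lc, (if x' = (Lc : ℤ) • y + toSite v then (1 : ℝ) else 0))
            - (1 / 2 : ℝ) * (∑ v ∈ box (3 + 1) Lc, (if x = (Lc : ℤ) • y + toSite v then (1 : ℝ) else 0))))) :
    (∀ j : ℕ, WardTransversal (flipK (TbalOf Lc (JsRowD1Pin hLc N) j)))
      ∧ (∀ j : ℕ, AxisReflectionCovariant (flipK (TbalOf Lc (JsRowD1Pin hLc N) j))) :=
  symmetries_JsRowD1Pin_of_bondLaws hLc hN (fun j => -((Lc : ℝ) ^ 8 / 2) * wVH 3 Lc j / (stepScale 3 Lc j * (Lc : ℝ) ^ 4))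
    (fun _ => rfl) (bondLaw hLc) hBb hWb hWM

open Classical in
/-- [folklore] **hW ∧ hR FOR `JsRowD1Pin hLc N` FROM `hBb` ∧ (W2-B) ∧ (W2-M)** — the border reflection bond law and an1's two SITE-LEVEL Ward laws
(`hSB`, `hSM`: WX5's hypothesis shapes verbatim; all three HYPOTHESES): WX5 `symmetries_JsRowD1Pin_of_siteLaws` with `hMb := RootedMixedTableLaw.bondLaw
hLc` and `γ` instantiated. -/
theorem symmetries_JsRowD1Pin_of_borderBondLaw_siteLaws (hLc : Odd Lc) {N : ℕ} (hN : 2 ≤ N)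
    (hBb : ∀ (α m : Fin 4) (y : Fin 4 → ℤ) (β : Fin 4) (x : Fin 4 → ℤ) (κ : Fin 4) (u : Fin 4 → ℤ) (κ' : Fin 4) (u' : Fin 4 → ℤ),
      reflSign α β * reflSign α κ * reflSign α κ' * reflSign α m *
          (vh2KerAt (toSite (ctrOff 4 Lc)) Lc m (bref α m y) (β, bref α β x) (κ, bref α κ u) (κ', bref α κ' u')
            + vh2KerAt (toSite (ctrOff 4 Lc)) Lc m (bref α m y) (β, bref α β x) (κ', bref α κ' u') (κ, bref α κ u))
        = (vh2KerAt (toSite (ctrOff 4 Lc)) Lc m y (β, x) (κ, u) (κ', u') + vh2KerAt (toSite (ctrOff 4 Lc)) Lc m y (β, x) (κ', u') (κ, u))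
          + 2 * (vhKerAt (toSite (ctrOff 4 Lc)) Lc m y (β, x) (κ', u')
                  * ((if m = α then linKerAt (toSite (ctrOff 4 Lc)) Lc m y (κ, u) else 0) - (if x = u ∧ β = κ ∧ κ = α then 1 else 0))
                + vhKerAt (toSite (ctrOff 4 Lc)) Lc m y (β, x) (κ, u)
                  * ((if m = α then linKerAt (toSite (ctrOff 4 Lc)) Lc m y (κ', u') else 0) - (if x = u' ∧ β = κ' ∧ κ' = α then 1 else 0))
                + linKerAt (toSite (ctrOff 4 Lc)) Lc m y (β, x)
                  * ((if m = α then linKerAt (toSite (ctrOff 4 Lc)) Lc m y (κ, u) else 0) - (if x = u ∧ β = κ ∧ κ = α then 1 else 0))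
                  * ((if m = α then linKerAt (toSite (ctrOff 4 Lc)) Lc m y (κ', u') else 0) - (if x = u' ∧ β = κ' ∧ κ' = α then 1 else 0))))
    (hSB : ∀ (u : Fin 4 → ℤ) (m : Fin 4) (y : Fin 4 → ℤ) (β : Fin 4) (x : Fin 4 → ℤ) (κ' : Fin 4) (u' : Fin 4 → ℤ),
      ∑ κ : Fin (3 + 1),
          ((1 / 2 : ℝ) * (vh2KerAt (toSite (ctrOff 4 Lc)) Lc m y (β, x) (κ, u - unitVec κ) (κ', u')
              + vh2KerAt (toSite (ctrOff 4 Lc)) Lc m y (β, x) (κ', u') (κ, u - unitVec κ))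
            - (1 / 2 : ℝ) * (vh2KerAt (toSite (ctrOff 4 Lc)) Lc m y (β, x) (κ, u) (κ', u')
              + vh2KerAt (toSite (ctrOff 4 Lc)) Lc m y (β, x) (κ', u') (κ, u))) =
        vhKerAt (toSite (ctrOff 4 Lc)) Lc m y (β, x) (κ', u')
          * ((if u = (Lc : ℤ) • y + toSite (ctrOff 4 Lc) then (1 : ℝ) else 0) - (if u = x then (1 : ℝ) else 0)))
    (hSM : ∀ (u : Fin 4 → ℤ) (ρ' : Fin 4) (w : Fin 4 → ℤ) (β : Fin 4) (x : Fin 4 → ℤ) (β' : Fin 4) (x' : Fin 4 → ℤ),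
      ∑ κ : Fin (3 + 1),
          (mixKerAt (toSite (ctrOff 4 Lc)) Lc ρ' w (κ, u - unitVec κ) (β, x) (β', x')
            - mixKerAt (toSite (ctrOff 4 Lc)) Lc ρ' w (κ, u) (β, x) (β', x')) =
        2 * hessKerAt (toSite (ctrOff 4 Lc)) Lc ρ' w (β, x) (β', x')
          * ((if u = (Lc : ℤ) • w + toSite (ctrOff 4 Lc) then (1 : ℝ) else 0) - (if u = x then (1 : ℝ) else 0))) :
    (∀ j : ℕ, WardTransversal (flipK (TbalOf Lc (JsRowD1Pin hLc N) j)))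
      ∧ (∀ j : ℕ, AxisReflectionCovariant (flipK (TbalOf Lc (JsRowD1Pin hLc N) j))) :=
  symmetries_JsRowD1Pin_of_siteLaws hLc hN (fun j => -((Lc : ℝ) ^ 8 / 2) * wVH 3 Lc j / (stepScale 3 Lc j * (Lc : ℝ) ^ 4))
    (fun _ => rfl) (bondLaw hLc) hBb hSB hSM

/-! ## §3 Binder row D1 for the pinned literal: `D1Drift` with the mixed reflection law discharged -/

open Classical in
/-- [folklore] **BINDER ROW D1 FOR `JsRowD1Pin hLc N` IN BOND CURRENCY, MIXED REFLECTION LAW DISCHARGED**: `D1Drift Lc (JsRowD1Pin hLc N) Nc μ ν` ⟸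
`hBb` ∧ `hWb` ∧ `hWM` ∧ `D1Tel Lc (JsRowD1Pin hLc N) Jc` ∧ `D1Rep Lc Jc Nc μ ν a SL k` (+ the route theorem's printed B5 facts, window, `μ ≠ ν`,
`Nc ≠ 0`, `2 ≤ Lc`, `2 ≤ N`; every remaining identity a HYPOTHESIS, verbatim from RX `d1Drift_JsRowD1Pin_of_bondLaws_D1Tel_D1Rep`), through the
route node `OneStepKernelFamily.d1Drift_of_D1Tel_D1Rep` BY NAME.  CONDITIONAL; `Nc` not pinned to `N` ((P6)). -/
theorem d1Drift_JsRowD1Pin_of_borderLaws_D1Tel_D1Rep (hLc : Odd Lc) (hL2 : 2 ≤ Lc) {N : ℕ} (hN : 2 ≤ N)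
    (hBb : ∀ (α m : Fin 4) (y : Fin 4 → ℤ) (β : Fin 4) (x : Fin 4 → ℤ) (κ : Fin 4) (u : Fin 4 → ℤ) (κ' : Fin 4) (u' : Fin 4 → ℤ),
      reflSign α β * reflSign α κ * reflSign α κ' * reflSign α m *
          (vh2KerAt (toSite (ctrOff 4 Lc)) Lc m (bref α m y) (β, bref α β x) (κ, bref α κ u) (κ', bref α κ' u')
            + vh2KerAt (toSite (ctrOff 4 Lc)) Lc m (bref α m y) (β, bref α β x) (κ', bref α κ' u') (κ, bref α κ u))
        = (vh2KerAt (toSite (ctrOff 4 Lc)) Lc m y (β, x) (κ, u) (κ', u') + vh2KerAt (toSite (ctrOff 4 Lc)) Lc m y (β, x) (κ', u') (κ, u))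
          + 2 * (vhKerAt (toSite (ctrOff 4 Lc)) Lc m y (β, x) (κ', u')
                  * ((if m = α then linKerAt (toSite (ctrOff 4 Lc)) Lc m y (κ, u) else 0) - (if x = u ∧ β = κ ∧ κ = α then 1 else 0))
                + vhKerAt (toSite (ctrOff 4 Lc)) Lc m y (β, x) (κ, u)
                  * ((if m = α then linKerAt (toSite (ctrOff 4 Lc)) Lc m y (κ', u') else 0) - (if x = u' ∧ β = κ' ∧ κ' = α then 1 else 0))
                + linKerAt (toSite (ctrOff 4 Lc)) Lc m y (β, x)
                  * ((if m = α then linKerAt (toSite (ctrOff 4 Lc)) Lc m y (κ, u) else 0) - (if x = u ∧ β = κ ∧ κ = α then 1 else 0))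
                  * ((if m = α then linKerAt (toSite (ctrOff 4 Lc)) Lc m y (κ', u') else 0) - (if x = u' ∧ β = κ' ∧ κ' = α then 1 else 0))))
    (hWb : ∀ (Y : Fin 4 → ℤ) (κ' : Fin 4) (u' x z : Fin 4 → ℤ) (β m : Fin 4), off Lc z = 0 →
      (stepScale 3 Lc 0 * (Lc : ℝ) ^ (3 + 1))⁻¹ *
          ∑ v ∈ box (3 + 1) Lc, ∑ κ : Fin (3 + 1),
            ((-((Lc : ℝ) ^ 12 / 4)) * ((1 / 2 : ℝ) * (vh2KerAt (toSite (ctrOff 4 Lc)) Lc m (blk Lc z) (β, x) (κ, (Lc : ℤ) • Y + toSite v - unitVec κ) (κ', u')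
                + vh2KerAt (toSite (ctrOff 4 Lc)) Lc m (blk Lc z) (β, x) (κ', u') (κ, (Lc : ℤ) • Y + toSite v - unitVec κ)))
              - (-((Lc : ℝ) ^ 12 / 4)) * ((1 / 2 : ℝ) * (vh2KerAt (toSite (ctrOff 4 Lc)) Lc m (blk Lc z) (β, x) (κ, (Lc : ℤ) • Y + toSite v) (κ', u')
                + vh2KerAt (toSite (ctrOff 4 Lc)) Lc m (blk Lc z) (β, x) (κ', u') (κ, (Lc : ℤ) • Y + toSite v)))) =
        (-((Lc : ℝ) ^ (3 + 1) * (1 / 2) * (Lc : ℝ) ^ (3 + 1))) * vhKerAt (toSite (ctrOff 4 Lc)) Lc m (blk Lc z) (β, x) (κ', u')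
            * ((1 / 2 : ℝ) * ∑ v ∈ box (3 + 1) Lc, (if z + toSite (ctrOff 4 Lc) = (Lc : ℤ) • Y + toSite v then (1 : ℝ) else 0))
          - ((1 / 2 : ℝ) * ∑ v ∈ box (3 + 1) Lc, (if x = (Lc : ℤ) • Y + toSite v then (1 : ℝ) else 0))
            * ((-((Lc : ℝ) ^ (3 + 1) * (1 / 2) * (Lc : ℝ) ^ (3 + 1))) * vhKerAt (toSite (ctrOff 4 Lc)) Lc m (blk Lc z) (β, x) (κ', u')))
    (hWM : ∀ (y : Fin (3 + 1) → ℤ) (ρ' : Fin (3 + 1)) (w : Fin (3 + 1) → ℤ) (β : Fin (3 + 1)) (x : Fin (3 + 1) → ℤ) (β' : Fin (3 + 1))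
      (x' : Fin (3 + 1) → ℤ),
      ((Lc : ℝ) ^ (3 + 1))⁻¹ * (∑ v ∈ box (3 + 1) Lc, ∑ κ : Fin (3 + 1),
          ((mixKerAt (toSite (ctrOff 4 Lc)) Lc ρ' w (κ, (Lc : ℤ) • y + toSite v - unitVec κ) (β, x) (β', x')
              - mixKerAt (toSite (ctrOff 4 Lc)) Lc ρ' w (κ, (Lc : ℤ) • y + toSite v) (β, x) (β', x'))
            + (mixKerAt (toSite (ctrOff 4 Lc)) Lc ρ' w (κ, (Lc : ℤ) • y + toSite v - unitVec κ) (β', x') (β, x)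
              - mixKerAt (toSite (ctrOff 4 Lc)) Lc ρ' w (κ, (Lc : ℤ) • y + toSite v) (β', x') (β, x)))) =
        2 * ((2 / (Lc : ℝ) ^ 4) * hessKerAt (toSite (ctrOff 4 Lc)) Lc ρ' w (β, x) (β', x') *
          ((1 / 2 : ℝ) * (∑ v ∈ box (3 + 1) Lc, (if x' = (Lc : ℤ) • y + toSite v then (1 : ℝ) else 0))
            - (1 / 2 : ℝ) * (∑ v ∈ box (3 + 1) Lc, (if x = (Lc : ℤ) • y + toSite v then (1 : ℝ) else 0)))))
    -- the route theorem's own binders (printed B5 facts, channel, colour parameter, window), verbatim from K-Q ∕ RX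
    (a : ℝ) (ha : 0 < a)
    (h12 : B5.Prop12Printed (fam (fun i : ℕ+ × ℕ => ((i.1 : ℕ+) : ℕ)) (fun i => i.1.pos) MvE a ha))
    (h126 : B5.Kernel126_127Printed (kfam (fun i : ℕ+ × ℕ => ((i.1 : ℕ+) : ℕ)) MvE))
    {L : Type*} {SL : Finset L} (hSL : SL.Nonempty) (k : L → Fin 4) {μ ν : Fin 4} (hμν : μ ≠ ν) {Nc : ℝ} (hNc : Nc ≠ 0)
    (Jc : ∀ m : ℕ, JetData 3 (Lc ^ m)) (htel : D1Tel Lc (JsRowD1Pin hLc N) Jc)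
    {cc : ℝ} {M : ℕ → ℕ} (hc : 1 ≤ cc) (hMw : ∀ L : ℕ, 2 ≤ L → 1 ≤ M L ∧ (L : ℝ) ≤ cc * M L) (hML : ∀ L : ℕ, 2 ≤ L → M L ≤ L)
    (hrep : D1Rep Lc Jc Nc μ ν a SL k) :
    D1Drift Lc (JsRowD1Pin hLc N) Nc μ ν := by
  obtain ⟨hW, hR⟩ := symmetries_JsRowD1Pin_of_borderBondLaw_bondWard hLc hN hBb hWb hWM
  exact d1Drift_of_D1Tel_D1Rep a ha h12 h126 hSL k hμν hNc hL2 (JsRowD1Pin hLc N) Jc hW hR htel hc hMw hML hrep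

open Classical in
/-- [folklore] **THE SAME WITH THE TWO SITE-LEVEL WARD LAWS** (W2-B) ∕ (W2-M) in place of the bond Ward identities: `D1Drift Lc (JsRowD1Pin hLc N) Nc μ ν`
⟸ `hBb` ∧ `hSB` ∧ `hSM` ∧ D1Tel ∧ D1Rep (+ the route binders); §2 `symmetries_JsRowD1Pin_of_borderBondLaw_siteLaws` into the route node BY NAME.
CONDITIONAL; every identity a HYPOTHESIS. -/
theorem d1Drift_JsRowD1Pin_of_borderBondLaw_siteLaws_D1Tel_D1Rep (hLc : Odd Lc) (hL2 : 2 ≤ Lc) {N : ℕ} (hN : 2 ≤ N)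
    (hBb : ∀ (α m : Fin 4) (y : Fin 4 → ℤ) (β : Fin 4) (x : Fin 4 → ℤ) (κ : Fin 4) (u : Fin 4 → ℤ) (κ' : Fin 4) (u' : Fin 4 → ℤ),
      reflSign α β * reflSign α κ * reflSign α κ' * reflSign α m *
          (vh2KerAt (toSite (ctrOff 4 Lc)) Lc m (bref α m y) (β, bref α β x) (κ, bref α κ u) (κ', bref α κ' u')
            + vh2KerAt (toSite (ctrOff 4 Lc)) Lc m (bref α m y) (β, bref α β x) (κ', bref α κ' u') (κ, bref α κ u))
        = (vh2KerAt (toSite (ctrOff 4 Lc)) Lc m y (β, x) (κ, u) (κ', u') + vh2KerAt (toSite (ctrOff 4 Lc)) Lc m y (β, x) (κ', u') (κ, u))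
          + 2 * (vhKerAt (toSite (ctrOff 4 Lc)) Lc m y (β, x) (κ', u')
                  * ((if m = α then linKerAt (toSite (ctrOff 4 Lc)) Lc m y (κ, u) else 0) - (if x = u ∧ β = κ ∧ κ = α then 1 else 0))
                + vhKerAt (toSite (ctrOff 4 Lc)) Lc m y (β, x) (κ, u)
                  * ((if m = α then linKerAt (toSite (ctrOff 4 Lc)) Lc m y (κ', u') else 0) - (if x = u' ∧ β = κ' ∧ κ' = α then 1 else 0))
                + linKerAt (toSite (ctrOff 4 Lc)) Lc m y (β, x)
                  * ((if m = α then linKerAt (toSite (ctrOff 4 Lc)) Lc m y (κ, u) else 0) - (if x = u ∧ β = κ ∧ κ = α then 1 else 0))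
                  * ((if m = α then linKerAt (toSite (ctrOff 4 Lc)) Lc m y (κ', u') else 0) - (if x = u' ∧ β = κ' ∧ κ' = α then 1 else 0))))
    (hSB : ∀ (u : Fin 4 → ℤ) (m : Fin 4) (y : Fin 4 → ℤ) (β : Fin 4) (x : Fin 4 → ℤ) (κ' : Fin 4) (u' : Fin 4 → ℤ),
      ∑ κ : Fin (3 + 1),
          ((1 / 2 : ℝ) * (vh2KerAt (toSite (ctrOff 4 Lc)) Lc m y (β, x) (κ, u - unitVec κ) (κ', u')
              + vh2KerAt (toSite (ctrOff 4 Lc)) Lc m y (β, x) (κ', u') (κ, u - unitVec κ))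
            - (1 / 2 : ℝ) * (vh2KerAt (toSite (ctrOff 4 Lc)) Lc m y (β, x) (κ, u) (κ', u')
              + vh2KerAt (toSite (ctrOff 4 Lc)) Lc m y (β, x) (κ', u') (κ, u))) =
        vhKerAt (toSite (ctrOff 4 Lc)) Lc m y (β, x) (κ', u')
          * ((if u = (Lc : ℤ) • y + toSite (ctrOff 4 Lc) then (1 : ℝ) else 0) - (if u = x then (1 : ℝ) else 0)))
    (hSM : ∀ (u : Fin 4 → ℤ) (ρ' : Fin 4) (w : Fin 4 → ℤ) (β : Fin 4) (x : Fin 4 → ℤ) (β' : Fin 4) (x' : Fin 4 → ℤ),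
      ∑ κ : Fin (3 + 1),
          (mixKerAt (toSite (ctrOff 4 Lc)) Lc ρ' w (κ, u - unitVec κ) (β, x) (β', x')
            - mixKerAt (toSite (ctrOff 4 Lc)) Lc ρ' w (κ, u) (β, x) (β', x')) =
        2 * hessKerAt (toSite (ctrOff 4 Lc)) Lc ρ' w (β, x) (β', x')
          * ((if u = (Lc : ℤ) • w + toSite (ctrOff 4 Lc) then (1 : ℝ) else 0) - (if u = x then (1 : ℝ) else 0)))
    (a : ℝ) (ha : 0 < a)
    (h12 : B5.Prop12Printed (fam (fun i : ℕ+ × ℕ => ((i.1 : ℕ+) : ℕ)) (fun i => i.1.pos) MvE a ha))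
    (h126 : B5.Kernel126_127Printed (kfam (fun i : ℕ+ × ℕ => ((i.1 : ℕ+) : ℕ)) MvE))
    {L : Type*} {SL : Finset L} (hSL : SL.Nonempty) (k : L → Fin 4) {μ ν : Fin 4} (hμν : μ ≠ ν) {Nc : ℝ} (hNc : Nc ≠ 0)
    (Jc : ∀ m : ℕ, JetData 3 (Lc ^ m)) (htel : D1Tel Lc (JsRowD1Pin hLc N) Jc)
    {cc : ℝ} {M : ℕ → ℕ} (hc : 1 ≤ cc) (hMw : ∀ L : ℕ, 2 ≤ L → 1 ≤ M L ∧ (L : ℝ) ≤ cc * M L) (hML : ∀ L : ℕ, 2 ≤ L → M L ≤ L)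
    (hrep : D1Rep Lc Jc Nc μ ν a SL k) :
    D1Drift Lc (JsRowD1Pin hLc N) Nc μ ν := by
  obtain ⟨hW, hR⟩ := symmetries_JsRowD1Pin_of_borderBondLaw_siteLaws hLc hN hBb hSB hSM
  exact d1Drift_of_D1Tel_D1Rep a ha h12 h126 hSL k hμν hNc hL2 (JsRowD1Pin hLc N) Jc hW hR htel hc hMw hML hrep

end

end Summit.QuantumFields.BalabanUV.Beta.RowD1MixedDischarged
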